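import Summits.QuantumFields.BalabanUV.Beta.FP.SliceGaugeLaw

/-!
# `BalabanUV.Beta.FP.SliceGaugeLawAssembly` — road «FP» for binder row D1, sub-row H2-ASM-5a «layer b», GLUON (a4-total): THE LETTER REDUCED TO ITS INVARIANT HALF,
# BOTH CONVENTION BRANCHES DISPLAYED — additivity of the gauge-commutator law + the two instantiations with `SliceGaugeLaw` ✓ (p251838)

HONEST DEPENDENCY (page 1, mandatory): continuum YM on T⁴ ⇐ BetaPertH ∧ nine spine estimates (0/9 proved); BetaPertH ⇐ (D1) ∧ (D4) ∧ CAP+tail;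
G-an2-4 gates asym, D1 and NE2/3/4.  HONEST FRAMING (cell contract, verbatim): «discharging `BetaPertH` makes Bałaban's UV stability UNCONDITIONAL —
a real constructive-QFT result; it is NOT the continuum limit and NOT the Clay problem.»  THIS MODULE DISCHARGES NOTHING of the wall: [folklore] additivity of
`KernelWard.divV` and of the commutator with the road's site projection `proj`, and two instantiations of landed theorems; 0 def, no `def … : Prop`, nothing cited,
0 sorry; 0∕4 row-D1 binders; NOT (a4-total) itself — its INVARIANT HALF (the perfect action's cubic jet `S∞³` against the `Δ_∞` block) is H2V-4′'s S-side and stays a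
HYPOTHESIS here; NOT (a8), NOT (K0), NOT D1, NOT BetaPertH, NOT continuum, NOT Clay.  «not in print; our bookkeeping».

ABSOLUTE RULE (cell charter, verbatim): «No internally-minted statement may enter as a cited fact. Every hypothesis is either kernel-proved in this package or a
verbatim quotation of a PUBLISHED theorem with page reference. The manuscript(s) under audit are NOT citable for their own disputed steps — they are the thing
under adjudication; programme-internal (2001/route/tribunal) claims are never citable.»

CONTENT (`ℤ⁴`, packed fibre `Fib 3`; transposes spelled as lambdas: `ddKerᶠ := fun x z a b => ddKer x z b a`, `sliceAᶠ := fun κ u x z a b => sliceA 3 κ u x z b a`,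
`MFᶠ := fun x z a b => MF x z b a`).
* §1 [folklore] ADDITIVITY: `divV_add`, `commutator_proj_add` (entrywise by `SliceGaugeLaw.commutator_proj_apply` — `proj y` is finitely supported, no summability),
  **`gauge_law_add`**: laws for `(V₁, M₁, c)` and `(V₂, M₂, c)` ⟹ the law for `(V₁ + V₂, M₁ + M₂, c)`.
* §2 BRANCH «MF's CONVENTION» (vertex data fibre-transposed, `PiBF`'s `MF`∕`Pker` as typed): dictionary `MF_sub_ddKerF_inl_inl : (MF − ddKerᶠ) x z (inl γ)(inl β) = deltaZLim (z,γ)(x,β)`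
  (+ the three vanishing blocks), and **`a4_total_of_inv_fibre : (∀ y, divV Vinv y = 1 • [MF − ddKerᶠ, Π_y]) → ∀ y, divV (Vinv + sliceAᶠ) y = 1 • [MF, Π_y]`** — W2's letter (a4-total)
  (`PerfectPolarizationWardLetters.wardTransversal_flip_PiBF_of_gauge_laws`, `c = 1`) follows from the INVARIANT HALF ALONE once the slice summand is fed fibre-transposed
  (`SliceGaugeLaw.divV_sliceA_fibreTranspose` ✓).
* §3 BRANCH «STRAIGHT» (`PiBF`'s data re-read fibre-transposed, vertex data as typed): dictionary `MFt_sub_ddKer_inl_inl : (MFᶠ − ddKer) x z (inl α)(inl β) = deltaZLim (x,α)(z,β)`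
  (the straight `Δ_∞` block), and **`a4_total_of_inv_straight : (∀ y, divV Vinv y = 1 • [MFᶠ − ddKer, Π_y]) → ∀ y, divV (Vinv + sliceA 3) y = 1 • [MFᶠ, Π_y]`**
  (`SliceGaugeLaw.divV_sliceA` ✓).
Nothing is chosen between §2 and §3: the H2V-4 S-side prover gets BOTH admissible closed-form targets for the perfect cubic jet; the road-FP owner's convention decision
(N-d1leaf02g9-1 ∕ L-gan24leaf02-g41-1) picks which one W2 consumes.
Provenance: G-an2-4 formalisation swarm seat b2b-balaban-gan24-formalise-leaf-02 gen 41 (cross-lane on road FP), 2026-08-21.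
-/

noncomputable section

namespace Summit.QuantumFields.BalabanUV.Beta.FP.SliceGaugeLawAssembly

open Finset
open scoped BigOperators
open Literature.MathematicalPhysics.QuantumFieldTheory.Balaban1983to89
open Literature.MathematicalPhysics.QuantumFieldTheory.Balaban1983to89.Beta
open ExpKernelCalculus (MKer Site comp)
open OneStepResolventKernel (Fib)
open KernelWard (divV)
open Summit.QuantumFields.BalabanUV.Beta.GAN24.EffectiveLaplacianLimit (deltaZLim deltaZLim_symm)
open Summit.QuantumFields.BalabanUV.Beta.FP.PerfectPropagatorInverse (MF MF_inl_inr MF_inr_inl MF_inr_inr)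
open Summit.QuantumFields.BalabanUV.Beta.FP.PerfectPolarizationWardLetters (fmask fmask_inl fmask_inr proj)
open Summit.QuantumFields.BalabanUV.Beta.FP.SliceVertex (sliceA)
open Summit.QuantumFields.BalabanUV.Beta.FP.SliceGaugeLaw (ddKer ddKer_inl_inr ddKer_inr_inl ddKer_inr_inr MF_inl_inl_eq_deltaZLim_add_ddKer divV_apply
  commutator_proj_apply divV_sliceA divV_sliceA_fibreTranspose)

/-! ## §1 [folklore] Additivity of the gauge-commutator law -/

/-- [folklore] the bond divergence is additive in the vertex family. -/
theorem divV_add (V₁ V₂ : Fin 4 → Site 4 → MKer 4 (Fib 3)) (y : Site 4) : divV (V₁ + V₂) y = divV V₁ y + divV V₂ y := by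
  funext x z a b
  simp only [Pi.add_apply, divV_apply]
  rw [← Finset.sum_add_distrib]
  exact Finset.sum_congr rfl fun μ _ => by ring

/-- [folklore] the commutator with the road's site projection is additive in the kernel (entrywise; `proj y` is finitely supported, no summability needed). -/
theorem commutator_proj_add (M₁ M₂ : MKer 4 (Fib 3)) (y : Site 4) :
    comp (M₁ + M₂) (proj y) - comp (proj y) (M₁ + M₂) = (comp M₁ (proj y) - comp (proj y) M₁) + (comp M₂ (proj y) - comp (proj y) M₂) := by
  funext x z a b
  rw [Pi.add_apply, Pi.add_apply, Pi.add_apply, Pi.add_apply, commutator_proj_apply, commutator_proj_apply, commutator_proj_apply]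
  simp only [Pi.add_apply]
  ring

/-- [folklore] **ADDITIVITY OF THE GAUGE-COMMUTATOR LAW**: if `divV V₁ y = c • [M₁, Π_y]` and `divV V₂ y = c • [M₂, Π_y]` for all `y`, then
`divV (V₁ + V₂) y = c • [M₁ + M₂, Π_y]`. -/
theorem gauge_law_add {V₁ V₂ : Fin 4 → Site 4 → MKer 4 (Fib 3)} {M₁ M₂ : MKer 4 (Fib 3)} {c : ℝ}
    (h₁ : ∀ y, divV V₁ y = c • (comp M₁ (proj y) - comp (proj y) M₁)) (h₂ : ∀ y, divV V₂ y = c • (comp M₂ (proj y) - comp (proj y) M₂)) (y : Site 4) :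
    divV (V₁ + V₂) y = c • (comp (M₁ + M₂) (proj y) - comp (proj y) (M₁ + M₂)) := by
  rw [divV_add, h₁ y, h₂ y, commutator_proj_add, smul_add]

/-! ## §2 Branch «MF's convention»: the slice summand fed fibre-transposed -/

/-- [our object] DICTIONARY: removing the (fibre-transposed) slice Hessian from `MF` leaves Bałaban's `Δ_∞` block in `MF`'s crosswise reading:
`(MF − ddKerᶠ) x z (inl γ) (inl β) = deltaZLim (z, γ) (x, β)`. -/
theorem MF_sub_ddKerF_inl_inl (x z : Site 4) (γ β : Fin 4) :
    (MF - fun x z a b => ddKer x z b a) x z (Sum.inl γ) (Sum.inl β) = deltaZLim (d := 3) (z, γ) (x, β) := by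
  simp only [Pi.sub_apply, MF_inl_inl_eq_deltaZLim_add_ddKer, add_sub_cancel_right]

/-- [our object] … the field–multiplier block of `MF − ddKerᶠ` vanishes. -/
theorem MF_sub_ddKerF_inl_inr (x z : Site 4) (γ j : Fin 4) : (MF - fun x z a b => ddKer x z b a) x z (Sum.inl γ) (Sum.inr j) = 0 := by
  simp only [Pi.sub_apply, MF_inl_inr, ddKer_inr_inl, sub_zero]

/-- [our object] … the multiplier–field block vanishes. -/
theorem MF_sub_ddKerF_inr_inl (x z : Site 4) (i β : Fin 4) : (MF - fun x z a b => ddKer x z b a) x z (Sum.inr i) (Sum.inl β) = 0 := by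
  simp only [Pi.sub_apply, MF_inr_inl, ddKer_inl_inr, sub_zero]

/-- [our object] … the multiplier block vanishes. -/
theorem MF_sub_ddKerF_inr_inr (x z : Site 4) (i j : Fin 4) : (MF - fun x z a b => ddKer x z b a) x z (Sum.inr i) (Sum.inr j) = 0 := by
  simp only [Pi.sub_apply, MF_inr_inr, ddKer_inr_inr, sub_zero]

/-- [our object] **(a4-total) FROM ITS INVARIANT HALF — BRANCH «MF's CONVENTION»**: if the (fibre-transposed) invariant cubic family `Vinv` obeys
`divV Vinv y = 1 • [MF − ddKerᶠ, Π_y]` (its divergence is the commutator of `MF`'s `Δ_∞` block with the site projection), then the TOTAL family `Vinv + sliceAᶠ` obeys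
W2's letter `divV V y = 1 • [MF, Π_y]` (`SliceGaugeLaw.divV_sliceA_fibreTranspose` ✓ supplies the slice half). -/
theorem a4_total_of_inv_fibre {Vinv : Fin 4 → Site 4 → MKer 4 (Fib 3)}
    (h : ∀ y, divV Vinv y = (1 : ℝ) • (comp (MF - fun x z a b => ddKer x z b a) (proj y) - comp (proj y) (MF - fun x z a b => ddKer x z b a)))
    (y : Site 4) :
    divV (Vinv + fun κ u x z a b => sliceA 3 κ u x z b a) y = (1 : ℝ) • (comp MF (proj y) - comp (proj y) MF) := by
  have e := gauge_law_add h divV_sliceA_fibreTranspose y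
  rwa [sub_add_cancel] at e

/-! ## §3 Branch «straight»: `PiBF`'s data re-read fibre-transposed, vertex data as typed -/

/-- [our object] DICTIONARY: the fibre-transposed `MF` minus the straight slice Hessian is the STRAIGHT `Δ_∞` block:
`(MFᶠ − ddKer) x z (inl α) (inl β) = deltaZLim (x, α) (z, β)`. -/
theorem MFt_sub_ddKer_inl_inl (x z : Site 4) (α β : Fin 4) :
    ((fun x z a b => MF x z b a) - ddKer) x z (Sum.inl α) (Sum.inl β) = deltaZLim (d := 3) (x, α) (z, β) := by
  simp only [Pi.sub_apply, MF_inl_inl_eq_deltaZLim_add_ddKer, add_sub_cancel_right]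
  exact deltaZLim_symm _ _

/-- [our object] … the field–multiplier block of `MFᶠ − ddKer` vanishes. -/
theorem MFt_sub_ddKer_inl_inr (x z : Site 4) (α j : Fin 4) : ((fun x z a b => MF x z b a) - ddKer) x z (Sum.inl α) (Sum.inr j) = 0 := by
  simp only [Pi.sub_apply, MF_inr_inl, ddKer_inl_inr, sub_zero]

/-- [our object] … the multiplier–field block vanishes. -/
theorem MFt_sub_ddKer_inr_inl (x z : Site 4) (i β : Fin 4) : ((fun x z a b => MF x z b a) - ddKer) x z (Sum.inr i) (Sum.inl β) = 0 := by
  simp only [Pi.sub_apply, MF_inl_inr, ddKer_inr_inl, sub_zero]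

/-- [our object] … the multiplier block vanishes. -/
theorem MFt_sub_ddKer_inr_inr (x z : Site 4) (i j : Fin 4) : ((fun x z a b => MF x z b a) - ddKer) x z (Sum.inr i) (Sum.inr j) = 0 := by
  simp only [Pi.sub_apply, MF_inr_inr, ddKer_inr_inr, sub_zero]

/-- [our object] **(a4-total) FROM ITS INVARIANT HALF — BRANCH «STRAIGHT»**: if the invariant cubic family `Vinv` (as typed, `wilsonA`'s convention) obeys
`divV Vinv y = 1 • [MFᶠ − ddKer, Π_y]` (the straight `Δ_∞` block), then the TOTAL family `Vinv + sliceA 3` obeys `divV V y = 1 • [MFᶠ, Π_y]` — W2's letter against the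
fibre-transposed `MF` (`SliceGaugeLaw.divV_sliceA` ✓ supplies the slice half). -/
theorem a4_total_of_inv_straight {Vinv : Fin 4 → Site 4 → MKer 4 (Fib 3)}
    (h : ∀ y, divV Vinv y = (1 : ℝ) • (comp ((fun x z a b => MF x z b a) - ddKer) (proj y) - comp (proj y) ((fun x z a b => MF x z b a) - ddKer)))
    (y : Site 4) :
    divV (Vinv + sliceA 3) y = (1 : ℝ) • (comp (fun x z a b => MF x z b a) (proj y) - comp (proj y) (fun x z a b => MF x z b a)) := by
  have e := gauge_law_add h divV_sliceA y
  rwa [sub_add_cancel] at e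

end Summit.QuantumFields.BalabanUV.Beta.FP.SliceGaugeLawAssembly

end
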